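import Summits.KontsevichZagierPeriods.Zeta5Search.LaiSweepShard

/-!
# `κ₃` sweep certificate — shard file 014 of 127 (shards 98–104 of 889)

HONEST FRAMING. Systematic search; no irrationality claim unless certified. This file only checks,
by `decide +kernel`, shards 98–104 of the order-cell sweep of the `κ₃` point `(74, 2180, 444; δ74)`
(engine `LaiSweepEngine`, soundness `LaiSweepJump/Free/Eval/Shard/Kappa3`; a shard is `⟨regime, n,
p, q, p', q', Lo, Up⟩`: `n` cells from `p/q` to `p'/q'` with integer rate sums in `[Lo, Up]`, `K =
128`, `D = 2^40`). It draws NO conclusion: only the capstone `LaiKappa3SweepCert`, which needs all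
127 shard files, does. Kernel cost of this file ≈ 560 cells × 0.3 s.
-/

namespace Summit.KontsevichZagierPeriods.Zeta5Search.Sweep

set_option maxHeartbeats 100000000 in
/-- Shard 98: 80 cells of regime A from `67/2606` to `67/2582`.
[cite: Lai2024BallRivoal, §4 Lemma 4.3] -/
theorem shard098 :
    Shard.check 128 (2^40)
      ⟨false, 80, 67, 2606, 67, 2582, 58186212891146, 58211815534896⟩ = true := by
  decide +kernel

set_option maxHeartbeats 100000000 in
/-- Shard 99: 80 cells of regime A from `67/2582` to `33/1261`.
[cite: Lai2024BallRivoal, §4 Lemma 4.3] -/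
theorem shard099 :
    Shard.check 128 (2^40)
      ⟨false, 80, 67, 2582, 33, 1261, 52803644867833, 52827543637191⟩ = true := by
  decide +kernel

set_option maxHeartbeats 100000000 in
/-- Shard 100: 80 cells of regime A from `33/1261` to `67/2536`.
[cite: Lai2024BallRivoal, §4 Lemma 4.3] -/
theorem shard100 :
    Shard.check 128 (2^40)
      ⟨false, 80, 33, 1261, 67, 2536, 58179037002455, 58211364334676⟩ = true := by
  decide +kernel

set_option maxHeartbeats 100000000 in
/-- Shard 101: 80 cells of regime A from `67/2536` to `69/2590`.
[cite: Lai2024BallRivoal, §4 Lemma 4.3] -/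
theorem shard101 :
    Shard.check 128 (2^40)
      ⟨false, 80, 67, 2536, 69, 2590, 50665327075944, 50688238167496⟩ = true := by
  decide +kernel

set_option maxHeartbeats 100000000 in
/-- Shard 102: 80 cells of regime A from `69/2590` to `61/2270`.
[cite: Lai2024BallRivoal, §4 Lemma 4.3] -/
theorem shard102 :
    Shard.check 128 (2^40)
      ⟨false, 80, 69, 2590, 61, 2270, 51854252745731, 51877869950989⟩ = true := by
  decide +kernel

set_option maxHeartbeats 100000000 in
/-- Shard 103: 80 cells of regime A from `61/2270` to `23/848`.
[cite: Lai2024BallRivoal, §4 Lemma 4.3] -/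
theorem shard103 :
    Shard.check 128 (2^40)
      ⟨false, 80, 61, 2270, 23, 848, 55424581418804, 55452491882133⟩ = true := by
  decide +kernel

set_option maxHeartbeats 100000000 in
/-- Shard 104: 80 cells of regime A from `23/848` to `61/2230`.
[cite: Lai2024BallRivoal, §4 Lemma 4.3] -/
theorem shard104 :
    Shard.check 128 (2^40)
      ⟨false, 80, 23, 848, 61, 2230, 50033171388320, 50056104611036⟩ = true := by
  decide +kernel

/-- The checked shards of this file, in order. [folklore] -/
def shards014 : List (CheckedShard 128 (2^40)) :=
  [⟨_, shard098⟩, ⟨_, shard099⟩, ⟨_, shard100⟩, ⟨_, shard101⟩, ⟨_, shard102⟩,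
    ⟨_, shard103⟩, ⟨_, shard104⟩]

end Summit.KontsevichZagierPeriods.Zeta5Search.Sweep
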